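import Literature.NumberTheory.EllipticCurves.GrossPointsPicardAction
import Mathlib.AlgebraicGeometry.EllipticCurve.LFunction
import Mathlib.RingTheory.ClassGroup.ExtendedHom
import Mathlib.NumberTheory.Padics.PadicIntegers
import Mathlib.Algebra.MonoidAlgebra.Basic
import HarnessLib

/-!
# Theta elements of Gross points on definite Shimura curves (Bertolini–Darmon)

Third file of the definition item `defn-GrossPointsThetaElement` (after `GrossPoints`,
`GrossPointsPicardAction`). We formalise, in the DEFINITE setting and on top of the tree's
Brandt module (`Literature.NumberTheory.Automorphic.BrandtXi`), §§2.4–2.7 and §2.12 of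

* [BertoliniDarmon1996] M. Bertolini, H. Darmon, *Heegner points on Mumford–Tate curves*,
  Invent. Math. 126 (1996) — the construction of the theta elements `θ_n ∈ ℤ_p[G_n]` and
  `θ = θ_∞ ∈ ℤ_p⟦G_∞⟧` from compatible Heegner (Gross) points of conductor `p^n`, and their order
  of vanishing —

together with the projection to the anticyclotomic `ℤ_p`-tower used in

* [BertoliniDarmon2005] Bertolini–Darmon, Ann. of Math. 162 (2005), §1.2 (`G̃_∞ = lim G̃_n`,
  `Δ` its torsion subgroup, `G_∞ = G̃_∞ / Δ ≃ ℤ_p`, `L_f =` image in `Λ = ℤ_p⟦G_∞⟧`,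
  `L_p(E, K) = L_f L_f^*`),

and the `μ = 0` theorem of Vatsal in the form printed by [PollackWeston2011], Thm. 2.3.

## The printed construction (BD96, definite case, `c = 1`, `E` ordinary at `p ∤ N`)

* §2.4 "A compatible system of points": for `P = (g × f)` a Heegner point of conductor `p^{n+1}`
  (`p ∤ N`) the `p + 1` points `(g_i × f)`, `(g_∞ × f)` — same `f`, `g` moved to a neighbour in
  the Bruhat–Tits tree at `p`, i.e. the lattice replaced by a sublattice of index `p²` (the
  lattices counted by the Brandt matrix `T(p)`, `Brandt.matrix`) — contain exactly one point
  `P̄` of conductor `p^n`; "choose points `P_n ∈ H_N(K; p^n)` which are compatible: `P̄_{n+1} =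
  P_n`". Here: `GrossSpace.IsPNeighbour`, `GrossPointTower S K p` (points `x_n` of conductor
  `p^n`, `x_n` a `p`-neighbour of `x_{n+1}`).
* §2.3, §2.5: `G_n = Pic(𝒪_{p^n})` acts on `H(K, p^n)` (file `GrossPointsPicardAction`);
  `y_n^σ := φ_E^*(P_n^σ) = ⟨P_n^σ, v_f⟩ ∈ ℤ` (`GrossSpace.yValue`, file `GrossPoints`), where
  `v_f` is a generator of the rank-one `f`-eigen-sublattice of `Pic X = ℤ[Cls O]` (§1.9; tree:
  `Brandt.eigenLattice`). Here: `GrossPointTower.y`.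
* §2.5 "Regularized Heegner points", Case 1 (`p ∤ N`): `α` the unit root of `x² - a_p x + p`,
  `z_n := α^{-n} y_n - α^{-(n+1)} y_{n-1}` for `n ≥ 1` (`y_{n-1}` pulled back along
  `G_n → G_{n-1}`); Prop. 2.7: the `z_n` are norm-compatible. Here: `GrossPointTower.z`, with the
  projections `picRes : Pic(𝒪_d) → Pic(𝒪_c)` (`c ∣ d`, Mathlib's `ClassGroup.extendedHom` along
  `𝒪_d ⊆ 𝒪_c`). The level-`0` regularisation `z_0` (involving `u = |𝒪_Kˣ/±1|` and the Frobenius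
  of the primes above `p`) is omitted: `θ_0` is the image of `θ_1` and plays no role below.
* §2.7 "The theta-elements": `θ_n := Σ_{σ ∈ G_n} z_n^σ · σ⁻¹ ∈ ℤ_p[G_n]` (here
  `GrossPointTower.theta n`, the element of level `n + 1`, in Mathlib's `MonoidAlgebra ℤ_[p] G`),
  "compatible under the natural projections `ℤ_p[G_{n+1}] → ℤ_p[G_n]`" (Cor. 2.8; here the
  predicate `GrossPointTower.IsNormCompatible`, a theorem of BD96 vendored as the named fact
  `grossPointTower_isNormCompatible`), and `θ = θ_∞ := lim θ_n ∈ ℤ_p⟦G_∞⟧ := lim ℤ_p[G_n]`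
  (here `completedGroupRing K p`, the subring of compatible families of `Π_n ℤ_p[G_{n+1}]`, and
  `GrossPointTower.thetaInfty`).
* §2.12: "Let `I_n` be the augmentation ideal in the group ring `ℤ_p[G_n]`. We say that `θ_n`
  vanishes to order `ρ` if `θ_n` belongs to `I_n^ρ`, and that `θ` vanishes to order `ρ` if `θ_n`
  vanishes to order `ρ` for all `n`. The order of vanishing of `θ` is the greatest `ρ` such that
  `θ` vanishes to order `ρ`." Here: `augIdeal`, `GrossPointTower.VanishesToOrder`,
  `GrossPointTower.orderOfVanishing : ℕ∞`. (BD96 Conj. 4.1: in the definite case the order of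
  vanishing is `max(r̃⁺, r̃⁻)`; Cor. 2.15: its parity.)
* BD05 §1.2: the anticyclotomic `p`-adic `L`-function is the image of `θ` in
  `Λ = ℤ_p⟦G̃_∞/Δ⟧`, `Δ` = torsion of `G̃_∞ = lim Pic(𝒪_{p^n})`. The image of `Δ` in `G_n` is the
  subgroup `torsionImage K p n` (elements admitting, for one exponent `e`, lifts of exponent `e`
  to every higher level), `G_n^{ac} := G_n / torsionImage` are the finite layers of
  `G_∞ ≃ ℤ_p`, and `thetaAc n` is the image of `θ_n` in `ℤ_p[G_n^{ac}]`; `acOrderOfVanishing`,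
  `VanishesToOrderAc` are the corresponding order of vanishing — equal to `ord_T` of BD05's
  `L_f ∈ ℤ_p⟦T⟧` once `Λ ≃ lim ℤ_p[G_n^{ac}]` is fixed (ideals of `Λ` are closed), which is the
  quantity `ord_J θ_∞` of the requesting route — and `HasMuZeroAc` (`θ_n^{ac} ∉ p ℤ_p[G_n^{ac}]`
  for `n ≫ 0`, i.e. `μ(L_f) = 0` in Pollack–Weston's normalisation "`μ(Q)` is the largest `c`
  with `Q ∈ 𝔭^c Λ`").
* Elliptic curves: for `E/ℚ` with model `W`, `eigenGenerator S (a(W))` is a generator `φ_E` of the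
  `a(E)`-eigen-line of the Brandt module when it is a line (sign ambiguity, BD96 §1.9; junk `0`
  otherwise) and `padicUnitRoot p (a_p)` the unit root `α_p` (junk `1` if there is none, i.e.
  `p ∣ a_p`); `thetaOfCurve W S T n` is BD96's `θ_{n+1}(E, K)`.

## Normalisations (checked against BD05 and Pollack–Weston)

`y(P) = w_{[I]} φ_{[I]}` is BD96's `⟨P, v_f⟩` and Pollack–Weston's `ψ_f(P) = ⟨P, g_f⟩` (§2.1,
`g_f` a generator of `ℳ^f`, i.e. `φ` up to `ℤ_pˣ`), and the value at the component of `P` of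
BD05's normalised eigenform `f_E` (functions on `Cls O` are the `w`-duals of divisors). BD05's
distribution `ν̃_f(σ U_j) = α_p^{-j} f_E(e_j)` on edges `e_j = (v_{j-1}, v_j)` of the tree, with
`f_E = f_s - α_p f_t` (Prop. 1.3), equals `-α_p · z_j` in BD96's normalisation; units of `ℤ_p`
and translation by group elements (choice of the end `(e_j)`, i.e. of the tower) change neither
orders of vanishing nor `μ`.

## What is NOT here (documented gaps)

* The interpolation property `|χ(θ)|² ≐ L(E/K, χ, 1) / (√D · Ω)` (Gross 1987 §11 for `N` prime
  and `χ` unramified; Zhang 2001 §1.4; BD96 Conj. 2.12; Chida–Hsieh 2015): the twisted values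
  `L(E/K, χ, 1)` for ring-class characters `χ` have no vocabulary in the tree yet.
* The identification `Λ = ℤ_p⟦T⟧ ≃ lim_n ℤ_p[G_n^{ac}]` (Iwasawa–Serre; needs a topological
  generator and the isomorphism `ℤ_p⟦ℤ_p⟧ ≃ ℤ_p⟦T⟧`, not in Mathlib) and the class-field-theoretic
  identification `Pic(𝒪_{p^n}) ≃ Gal(K_{p^n}/K)` (ring class fields; BD96 §2.3 "Class field
  theory") — the definite construction needs neither (BD96 p. 432: on definite curves "the action
  of `Pic(𝒪_n)` … does not correspond to any Galois action").
* Existence of towers (`H(K, p^n) ≠ ∅` iff the primes of `N⁺` split and those of `N⁻` are inert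
  in `K`, BD96 Lemma 2.2, and the tree structure of §2.4), finiteness of `Pic(𝒪_{p^n})`
  (Neukirch I (12.12); the definitions take the junk value `0` on an infinite class group, cf.
  `theta_eq_sum`), freeness of the action and the count `2^t h` (BD96 Lemma 2.5).

## References

* [BertoliniDarmon1996] §1.9, §2.3–2.7, §2.12, Conj. 4.1.
* [BertoliniDarmon2005] §1.1 (Prop. 1.3–1.4), §1.2 ((13), (18)–(21), Def. 1.6), Cor. 3.
* [PollackWeston2011] §2.1 (ψ_f, ξ), §2.3 Thm. 2.3 (Vatsal: `μ(L_p(f, K)) = 0`).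
* [Vatsal2003] V. Vatsal, *Special values of anticyclotomic `L`-functions*, Duke Math. J. 116
  (2003), Thm. 1.1 (the original `μ`-invariant theorem).
* [Gross1987] §3 (special points `x_𝔞`), §11 (special value formula).
-/

noncomputable section

open scoped Pointwise nonZeroDivisors
open NumberField Literature.NumberTheory.Automorphic

universe u v

namespace Literature.NumberTheory.EllipticCurves

variable {D : Type v} [Ring D] [Algebra ℚ D] {K : Type u} [Field K] [NumberField K]

/-! ### `p`-neighbours and towers of Gross points (BD96 §2.4) -/

namespace GrossSpace

/-- `x'` is a **`p`-neighbour** of `x`: there are representatives `(f, I)` of `x` and `(f, J)` of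
`x'` with the *same* embedding `f` and `J ⊆ I` a sublattice of index `p²` — the lattices
entering the Brandt matrix `T(p)` (`Brandt.matrix`), i.e. `g` replaced by one of its `p + 1`
neighbours in the Bruhat–Tits tree at `p` (BD96 §2.4: the points `(g_i × f)`, `(g_∞ × f)`).
Symmetric up to the central unit `p ∈ Dˣ` (`p I ⊆ J ⊆ I`). [cite: BertoliniDarmon1996, §2.4] -/
def IsPNeighbour (p : ℕ) (x x' : GrossSpace D K) : Prop :=
  ∃ (f : K →ₐ[ℚ] D) (I J : Submodule ℤ D), mk ⟨f, I⟩ = x ∧ mk ⟨f, J⟩ = x' ∧ J ≤ I ∧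
    J.toAddSubgroup.relIndex I.toAddSubgroup = p ^ 2

end GrossSpace

variable (K) in
/-- A **tower of Gross points** (compatible system of Heegner points of `p`-power conductor,
BD96 §2.4, with `c = 1`) on the definite Shimura set of the Brandt setup `S`: points `x_n` of
conductor `p^n` (`x_n ∈ grossPoints K S (p^n)`, so `x_0` has conductor `1`: an optimal embedding
of `𝓞_K`) such that `x_n` is a `p`-neighbour of `x_{n+1}` ("`P̄_{n+1} = P_n`": among the `p + 1`
neighbours of a point of conductor `p^{n+1}` exactly one has conductor `p^n`). [cite: BertoliniDarmon1996, §2.4] -/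
structure GrossPointTower {Nplus Nminus : ℕ} (S : Brandt.XiSetup Nplus Nminus) (p : ℕ) where
  /-- The points `x_n`, `n ≥ 0`. -/
  pt : ℕ → GrossSpace S.D K
  /-- `x_n` is a Gross point of conductor `p^n`. -/
  mem_grossPoints : ∀ n, pt n ∈ grossPoints K S (p ^ n)
  /-- `x_n` is a `p`-neighbour of `x_{n+1}`. -/
  isPNeighbour : ∀ n, (pt (n + 1)).IsPNeighbour p (pt n)

/-! ### The ring class groups `G_n = Pic(𝒪_{p^n})` and their projections -/

section Pic

variable (K)

/-- The **restriction map `Pic(𝒪_d) → Pic(𝒪_c)`**, `[𝔞] ↦ [𝔞 𝒪_c]`, for `c ∣ d` (so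
`𝒪_d ⊆ 𝒪_c`): Mathlib's `ClassGroup.extendedHom` along the inclusion of orders. For
`d = p^{n+1}`, `c = p^n` this is BD96's projection `G_{n+1} → G_n` (restriction
`Gal(K_{n+1}/K) → Gal(K_n/K)` of ring class fields under class field theory). [cite: BertoliniDarmon1996, §2.4–2.5] -/
def picRes {c d : ℕ} (h : c ∣ d) : ClassGroup (quadOrder K d) →* ClassGroup (quadOrder K c) :=
  letI : Algebra (quadOrder K d) (quadOrder K c) :=
    (Subalgebra.inclusion (quadOrder_le_of_dvd h)).toRingHom.toAlgebra
  haveI : NoZeroSMulDivisors (quadOrder K d) (quadOrder K c) := ⟨fun {a b} hab => by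
    have hab' : ((a : K) * (b : K)) = 0 := congrArg Subtype.val hab
    rcases mul_eq_zero.mp hab' with h0 | h0
    · exact Or.inl (Subtype.ext h0)
    · exact Or.inr (Subtype.ext h0)⟩
  ClassGroup.extendedHom (quadOrder K d) (quadOrder K c)

variable (p : ℕ)

/-- **The image of the torsion of `G̃_∞ = lim_m Pic(𝒪_{p^m})` in `G_n = Pic(𝒪_{p^n})`**
(BD05 §1.2: "Let `Δ` denote the torsion subgroup of `G̃_∞`, and let `G_∞ = G̃_∞/Δ ≃ ℤ_p`"): the
classes `g` admitting, for one exponent `e ≥ 1`, a lift of exponent `e` to every level `p^m`,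
`m ≥ n`. (By compactness this is exactly the image of `Δ`; it contains the prime-to-`p` part of
`G_n` and, when `p ∣ #Pic(𝓞_K)`, possibly more.) [cite: BertoliniDarmon2005, §1.2 (21)] -/
def torsionImage (n : ℕ) : Subgroup (ClassGroup (quadOrder K (p ^ n))) where
  carrier := {g | ∃ e : ℕ, 0 < e ∧ ∀ m (h : n ≤ m),
    ∃ g' : ClassGroup (quadOrder K (p ^ m)), g' ^ e = 1 ∧ picRes K (pow_dvd_pow p h) g' = g}
  one_mem' := ⟨1, Nat.one_pos, fun m _ => ⟨1, one_pow 1, map_one _⟩⟩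
  mul_mem' := by
    rintro g₁ g₂ ⟨e₁, he₁, h₁⟩ ⟨e₂, he₂, h₂⟩
    refine ⟨e₁ * e₂, Nat.mul_pos he₁ he₂, fun m hm => ?_⟩
    obtain ⟨g₁', hg₁, rfl⟩ := h₁ m hm
    obtain ⟨g₂', hg₂, rfl⟩ := h₂ m hm
    refine ⟨g₁' * g₂', ?_, map_mul _ _ _⟩
    rw [mul_pow, pow_mul, hg₁, one_pow, mul_comm e₁, pow_mul, hg₂, one_pow, one_mul]
  inv_mem' := by
    rintro g ⟨e, he, h⟩
    refine ⟨e, he, fun m hm => ?_⟩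
    obtain ⟨g', hg, rfl⟩ := h m hm
    exact ⟨g'⁻¹, by rw [inv_pow, hg, inv_one], map_inv _ _⟩

/-- The **`n`-th anticyclotomic layer group** `G_n^{ac} := G_n / (image of Δ)`: the finite
quotients of `G_∞ = G̃_∞ / Δ ≃ ℤ_p` (BD05 §1.2), i.e. — under class field theory — the Galois
groups of the layers of the anticyclotomic `ℤ_p`-extension of `K` contained in the ring class
fields of conductor `p^n`. [cite: BertoliniDarmon2005, §1.2 (21)] -/
abbrev AcLayerGroup (n : ℕ) : Type u :=
  ClassGroup (quadOrder K (p ^ n)) ⧸ torsionImage K p n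

/-- The projection `G_n → G_n^{ac}`. [folklore] -/
abbrev acProj (n : ℕ) : ClassGroup (quadOrder K (p ^ n)) →* AcLayerGroup K p n :=
  QuotientGroup.mk' (torsionImage K p n)

end Pic

/-! ### Group rings: augmentation ideals, projections, the completed group ring -/

section GroupRing

variable (R : Type*) [CommRing R] (G : Type*) [CommGroup G]

/-- The **augmentation** `ε : R[G] → R`, `σ ↦ 1` (the `R`-algebra map induced by the trivial
character). [folklore] -/
def augmentation : MonoidAlgebra R G →ₐ[R] R :=
  MonoidAlgebra.lift R R G (1 : G →* R)

/-- `ε(σ) = 1`, more generally `ε(r σ) = r`. [folklore] -/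
@[simp] theorem augmentation_single (σ : G) (r : R) :
    augmentation R G (MonoidAlgebra.single σ r) = r := by
  rw [augmentation, MonoidAlgebra.lift_single, MonoidHom.one_apply, smul_eq_mul, mul_one]

/-- The **augmentation ideal** `I_G = ker(ε : R[G] → R, σ ↦ 1)` of the group ring `R[G]`
(BD96 §2.12: "Let `I_n` be the augmentation ideal in the group ring `ℤ_p[G_n]`"). [folklore] -/
def augIdeal : Ideal (MonoidAlgebra R G) :=
  RingHom.ker (augmentation R G)

/-- Membership in the augmentation ideal: `ε θ = 0`. [folklore] -/
theorem mem_augIdeal_iff {θ : MonoidAlgebra R G} : θ ∈ augIdeal R G ↔ augmentation R G θ = 0 :=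
  RingHom.mem_ker

/-- `σ - 1 ∈ I_G` for `σ ∈ G` (these generate `I_G`). [folklore] -/
theorem single_sub_one_mem_augIdeal (σ : G) :
    MonoidAlgebra.single σ (1 : R) - 1 ∈ augIdeal R G := by
  rw [mem_augIdeal_iff, map_sub, map_one, augmentation_single, sub_self]

/-- The augmentation is compatible with maps of groups: `ε_H ∘ f_* = ε_G`. [folklore] -/
theorem augmentation_comp_mapDomainRingHom {H : Type*} [CommGroup H] (f : G →* H) :
    (augmentation R H : MonoidAlgebra R H →+* R).comp (MonoidAlgebra.mapDomainRingHom R f) =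
      (augmentation R G : MonoidAlgebra R G →+* R) := by
  refine MonoidAlgebra.ringHom_ext (fun r => ?_) (fun g => ?_)
  · simp [MonoidAlgebra.mapDomainRingHom, MonoidAlgebra.mapDomain_single]
  · simp [MonoidAlgebra.mapDomainRingHom, MonoidAlgebra.mapDomain_single]

/-- Hence the image of `I_G^ρ` under `f_* : R[G] → R[H]` lies in `I_H^ρ`. [folklore] -/
theorem map_augIdeal_pow_le {H : Type*} [CommGroup H] (f : G →* H) (ρ : ℕ) :
    (augIdeal R G ^ ρ).map (MonoidAlgebra.mapDomainRingHom R f) ≤ augIdeal R H ^ ρ := by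
  rw [Ideal.map_pow]
  refine Ideal.pow_right_mono ?_ ρ
  rw [Ideal.map_le_iff_le_comap]
  intro θ hθ
  rw [Ideal.mem_comap, mem_augIdeal_iff]
  rw [mem_augIdeal_iff] at hθ
  have := RingHom.congr_fun (augmentation_comp_mapDomainRingHom R G f) θ
  rw [RingHom.comp_apply, RingHom.coe_coe, RingHom.coe_coe] at this
  rw [this, hθ]

end GroupRing

section Theta

variable (K) (p : ℕ) [Fact p.Prime]

/-- The **projection of group rings `ℤ_p[G_{n+2}] → ℤ_p[G_{n+1}]`** induced by
`G_{n+2} → G_{n+1}` (BD96 §2.7: "the natural homomorphisms `ℤ_p[G_n] → ℤ_p[G_m]` induced from the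
projections `G_n → G_m`"). [cite: BertoliniDarmon1996, §2.7] -/
def groupRingProj (n : ℕ) :
    MonoidAlgebra ℤ_[p] (ClassGroup (quadOrder K (p ^ (n + 2)))) →+*
      MonoidAlgebra ℤ_[p] (ClassGroup (quadOrder K (p ^ (n + 1)))) :=
  MonoidAlgebra.mapDomainRingHom ℤ_[p] (picRes K (pow_dvd_pow p (n + 1).le_succ))

/-- **The completed group ring `ℤ_p⟦G_∞⟧ = lim_n ℤ_p[G_n]`** of BD96 §2.7, realised as the
subring of compatible families `(θ_{n+1})_{n ≥ 0} ∈ Π_n ℤ_p[G_{n+1}]` (levels `p^{n+1}`,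
`n ≥ 0`; level `0` is determined by level `1`). Its quotient by the image of `Δ` is BD05's
Iwasawa algebra `Λ = ℤ_p⟦G_∞⟧ ≃ ℤ_p⟦T⟧` (not constructed here). [cite: BertoliniDarmon1996, §2.7] -/
def completedGroupRing :
    Subring ((n : ℕ) → MonoidAlgebra ℤ_[p] (ClassGroup (quadOrder K (p ^ (n + 1))))) where
  carrier := {θ | ∀ n, groupRingProj K p n (θ (n + 1)) = θ n}
  mul_mem' ha hb n := by rw [Pi.mul_apply, map_mul, ha n, hb n, Pi.mul_apply]
  one_mem' n := by rw [Pi.one_apply, map_one, Pi.one_apply]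
  add_mem' ha hb n := by rw [Pi.add_apply, map_add, ha n, hb n, Pi.add_apply]
  zero_mem' n := by rw [Pi.zero_apply, map_zero, Pi.zero_apply]
  neg_mem' ha n := by rw [Pi.neg_apply, map_neg, ha n, Pi.neg_apply]

omit [NumberField K] in
/-- Membership in the completed group ring is compatibility under the projections. [folklore] -/
theorem mem_completedGroupRing_iff
    {θ : (n : ℕ) → MonoidAlgebra ℤ_[p] (ClassGroup (quadOrder K (p ^ (n + 1))))} :
    θ ∈ completedGroupRing K p ↔ ∀ n, groupRingProj K p n (θ (n + 1)) = θ n :=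
  Iff.rfl

variable {K} {Nplus Nminus : ℕ} {S : Brandt.XiSetup Nplus Nminus}
  (φ : Brandt.ClassSet S.O → ℤ) (α : ℤ_[p]ˣ) (T : GrossPointTower K S p)

namespace GrossPointTower

/-! #### `y`, `z`, `θ` (BD96 §2.5, §2.7) -/

/-- **`y_n(σ) := ⟨σ • x_n, φ⟩ ∈ ℤ`** for `σ ∈ G_n = Pic(𝒪_{p^n})` (BD96 §2.5:
`y_n^σ := φ_E^*(P_n^σ) = ⟨P_n^σ, v_f⟩`, with `φ = v_f`). [cite: BertoliniDarmon1996, §2.5] -/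
def y (n : ℕ) (σ : ClassGroup (quadOrder K (p ^ n))) : ℤ :=
  (σ • T.pt n).yValue S φ

/-- **The regularised values** `z_{n+1}(σ) := α^{-(n+1)} y_{n+1}(σ) - α^{-(n+2)} y_n(σ̄) ∈ ℤ_p`
for `σ ∈ G_{n+1}`, `σ̄` its image in `G_n` (BD96 §2.5, Case 1: "`z_n = α^{-n} y_n -
α^{-(n+1)} y_{n-1}` if `n ≥ 1`", `α` the unit root of `x² - a_p x + p`). [cite: BertoliniDarmon1996, §2.5] -/
def z (n : ℕ) (σ : ClassGroup (quadOrder K (p ^ (n + 1)))) : ℤ_[p] :=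
  ((α⁻¹ ^ (n + 1) : ℤ_[p]ˣ) : ℤ_[p]) * (T.y p φ (n + 1) σ : ℤ_[p]) -
    ((α⁻¹ ^ (n + 2) : ℤ_[p]ˣ) : ℤ_[p]) * (T.y p φ n (picRes K (pow_dvd_pow p n.le_succ) σ) : ℤ_[p])

open scoped Classical in
/-- **The theta element of level `n + 1`**, `θ_{n+1} := Σ_{σ ∈ G_{n+1}} z_{n+1}(σ) · σ⁻¹ ∈
ℤ_p[G_{n+1}]`, `G_{n+1} = Pic(𝒪_{p^{n+1}})` (BD96 §2.7: "`θ_n = Σ_{σ ∈ G_n} (z̃_n^σ) · σ⁻¹ ∈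
ℤ_p[G_n]`"; in the definite case `z̃_n = z_n`, §2.6). The class group of an order is finite
(Neukirch I (12.12)); should it not be, the junk value is `0`. [cite: BertoliniDarmon1996, §2.7] -/
def theta (n : ℕ) : MonoidAlgebra ℤ_[p] (ClassGroup (quadOrder K (p ^ (n + 1)))) :=
  if h : Finite (ClassGroup (quadOrder K (p ^ (n + 1)))) then
    letI := @Fintype.ofFinite (ClassGroup (quadOrder K (p ^ (n + 1)))) h
    ∑ σ, MonoidAlgebra.single σ⁻¹ (T.z p φ α n σ)
  else 0

/-- `θ_{n+1} = Σ_σ z_{n+1}(σ) σ⁻¹` for any enumeration of the (finite) class group. [folklore] -/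
theorem theta_eq_sum (n : ℕ) [Fintype (ClassGroup (quadOrder K (p ^ (n + 1))))] :
    T.theta p φ α n = ∑ σ, MonoidAlgebra.single σ⁻¹ (T.z p φ α n σ) := by
  rw [theta, dif_pos (Finite.of_fintype _)]
  congr!

/-- **Norm-compatibility** of the theta elements: `θ_{n+1} ↦ θ_n` under `ℤ_p[G_{n+1}] →
ℤ_p[G_n]` for all `n ≥ 1`, i.e. `(θ_{n+1})_n` lies in the completed group ring `ℤ_p⟦G_∞⟧`
(BD96 Prop. 2.7 / Cor. 2.8: "the elements `θ_n` are compatible under the natural projections").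
A *predicate*; that it holds for every tower of an ordinary setup is the named fact
`grossPointTower_isNormCompatible`. [cite: BertoliniDarmon1996, Prop. 2.7 and §2.7] -/
def IsNormCompatible : Prop :=
  T.theta p φ α ∈ completedGroupRing K p

/-- **`θ = θ_∞ := lim θ_n ∈ ℤ_p⟦G_∞⟧`** (BD96 §2.7): the family `(θ_{n+1})_{n ≥ 0}` as an
element of the completed group ring, *given* its norm-compatibility `h`. [cite: BertoliniDarmon1996, §2.7] -/
def thetaInfty (h : T.IsNormCompatible p φ α) : completedGroupRing K p :=
  ⟨T.theta p φ α, h⟩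

/-! #### Order of vanishing (BD96 §2.12) -/

/-- **`θ` vanishes to order `ρ`**: `θ_n ∈ I_n^ρ` for every level `n ≥ 1`, `I_n` the augmentation
ideal of `ℤ_p[G_n]` (BD96 §2.12: "`θ_n` vanishes to order `ρ` if `θ_n` belongs to `I_n^ρ`, and
… `θ` vanishes to order `ρ` if `θ_n` vanishes to order `ρ` for all `n`"; level `0` follows from
level `1`). [cite: BertoliniDarmon1996, §2.12] -/
def VanishesToOrder (ρ : ℕ) : Prop :=
  ∀ n, T.theta p φ α n ∈ augIdeal ℤ_[p] (ClassGroup (quadOrder K (p ^ (n + 1)))) ^ ρ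

/-- **The order of vanishing of `θ`**: "the greatest `ρ` such that `θ` vanishes to order `ρ`"
(BD96 §2.12), as an extended natural number (`⊤` if `θ` vanishes to every order, e.g. `θ = 0`).
BD96 Conj. 4.1 (definite case): it equals `max(r̃⁺, r̃⁻)`. [cite: BertoliniDarmon1996, §2.12] -/
def orderOfVanishing : ℕ∞ :=
  ⨆ (ρ : ℕ) (_ : T.VanishesToOrder p φ α ρ), (ρ : ℕ∞)

variable {p φ α T} in
/-- Vanishing to order `ρ` implies vanishing to every smaller order (`I^ρ ⊆ I^ρ'`). [folklore] -/
theorem VanishesToOrder.mono {ρ ρ' : ℕ} (h : T.VanishesToOrder p φ α ρ) (hle : ρ' ≤ ρ) :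
    T.VanishesToOrder p φ α ρ' :=
  fun n => Ideal.pow_le_pow_right hle (h n)

/-- `θ` vanishes to order `0`. [folklore] -/
theorem vanishesToOrder_zero : T.VanishesToOrder p φ α 0 :=
  fun n => by rw [pow_zero, Ideal.one_eq_top]; exact Submodule.mem_top

variable {p φ α T} in
/-- If `θ` vanishes to order `ρ` then `ρ ≤` its order of vanishing. [folklore] -/
theorem le_orderOfVanishing {ρ : ℕ} (h : T.VanishesToOrder p φ α ρ) :
    (ρ : ℕ∞) ≤ T.orderOfVanishing p φ α :=
  le_iSup₂ (f := fun (ρ : ℕ) (_ : T.VanishesToOrder p φ α ρ) => (ρ : ℕ∞)) ρ h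

variable {p φ α T} in
/-- If `θ` does not vanish to order `ρ + 1`, its order of vanishing is `≤ ρ`. [folklore] -/
theorem orderOfVanishing_le {ρ : ℕ} (h : ¬ T.VanishesToOrder p φ α (ρ + 1)) :
    T.orderOfVanishing p φ α ≤ ρ := by
  refine iSup₂_le fun ρ' h' => ?_
  by_contra hlt
  exact h (h'.mono (by simpa using (not_le.mp hlt)))

/-! #### The anticyclotomic projection (BD05 §1.2) and `μ` -/

/-- **The anticyclotomic theta element of level `n + 1`**: the image `θ_{n+1}^{ac}` of `θ_{n+1}`
in `ℤ_p[G_{n+1}^{ac}]`, `G^{ac} = G / (image of Δ)` (BD05 §1.2: "Write `L_f` for the natural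
image of `L̃_f` in the Iwasawa algebra `Λ = ℤ_p⟦G_∞⟧`", `G_∞ = G̃_∞/Δ`). [cite: BertoliniDarmon2005, §1.2 (21)] -/
def thetaAc (n : ℕ) : MonoidAlgebra ℤ_[p] (AcLayerGroup K p (n + 1)) :=
  MonoidAlgebra.mapDomainRingHom ℤ_[p] (acProj K p (n + 1)) (T.theta p φ α n)

/-- `θ^{ac}` vanishes to order `ρ`: `θ_n^{ac} ∈ I^ρ` in `ℤ_p[G_n^{ac}]` for all `n ≥ 1` — the
finite-level form of `L_f ∈ J^ρ`, `J = (γ - 1) = (T)` the augmentation ideal of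
`Λ = ℤ_p⟦G_∞⟧ ≃ ℤ_p⟦T⟧` (ideals of `Λ` are closed, so `L_f ∈ T^ρ Λ` iff all its finite images lie
in `I^ρ`). [cite: BertoliniDarmon2005, §1.2 and Cor. 3] -/
def VanishesToOrderAc (ρ : ℕ) : Prop :=
  ∀ n, T.thetaAc p φ α n ∈ augIdeal ℤ_[p] (AcLayerGroup K p (n + 1)) ^ ρ

/-- **`ord_J θ_∞`**, the order of vanishing of the anticyclotomic `p`-adic `L`-function
`L_f` (= `½ ord` of `L_p(E, K) = L_f L_f^*`) at the trivial character, in finite-level form: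
the greatest `ρ` with `θ_n^{ac} ∈ I^ρ` for all `n` (`⊤` if all). BD05 Cor. 3:
`ord_{s=1} L_p(E, K, s) ≥ 2 max(r̃⁺, r̃⁻)` for `p` good ordinary. [cite: BertoliniDarmon2005, §1.2 and Cor. 3] -/
def acOrderOfVanishing : ℕ∞ :=
  ⨆ (ρ : ℕ) (_ : T.VanishesToOrderAc p φ α ρ), (ρ : ℕ∞)

variable {p φ α T} in
/-- `I^ρ ⊆ I^ρ'` for `ρ' ≤ ρ`: anticyclotomic version of `VanishesToOrder.mono`. [folklore] -/
theorem VanishesToOrderAc.mono {ρ ρ' : ℕ} (h : T.VanishesToOrderAc p φ α ρ) (hle : ρ' ≤ ρ) :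
    T.VanishesToOrderAc p φ α ρ' :=
  fun n => Ideal.pow_le_pow_right hle (h n)

/-- `θ^{ac}` vanishes to order `0`. [folklore] -/
theorem vanishesToOrderAc_zero : T.VanishesToOrderAc p φ α 0 :=
  fun n => by rw [pow_zero, Ideal.one_eq_top]; exact Submodule.mem_top

variable {p φ α T} in
/-- If `θ^{ac}` vanishes to order `ρ` then `ρ ≤ ord_J(θ^{ac})`. [folklore] -/
theorem le_acOrderOfVanishing {ρ : ℕ} (h : T.VanishesToOrderAc p φ α ρ) :
    (ρ : ℕ∞) ≤ T.acOrderOfVanishing p φ α :=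
  le_iSup₂ (f := fun (ρ : ℕ) (_ : T.VanishesToOrderAc p φ α ρ) => (ρ : ℕ∞)) ρ h

variable {p φ α T} in
/-- If `θ^{ac}` does not vanish to order `ρ + 1`, then `ord_J(θ^{ac}) ≤ ρ`. [folklore] -/
theorem acOrderOfVanishing_le {ρ : ℕ} (h : ¬ T.VanishesToOrderAc p φ α (ρ + 1)) :
    T.acOrderOfVanishing p φ α ≤ ρ := by
  refine iSup₂_le fun ρ' h' => ?_
  by_contra hlt
  exact h (h'.mono (by simpa using (not_le.mp hlt)))

variable {p φ α T} in
/-- **Finite-level certificate** for `ord_J(θ^{ac}) ≤ ρ`: one level `n + 1` at which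
`θ_{n+1}^{ac} ∉ I^{ρ+1}` (the shape of the certificates `θ_n ∉ I_n³` of the requesting cards). [folklore] -/
theorem acOrderOfVanishing_le_of_not_mem {ρ : ℕ} (n : ℕ)
    (h : T.thetaAc p φ α n ∉ augIdeal ℤ_[p] (AcLayerGroup K p (n + 1)) ^ (ρ + 1)) :
    T.acOrderOfVanishing p φ α ≤ ρ :=
  acOrderOfVanishing_le fun hall => h (hall n)

variable {p φ α T} in
/-- Vanishing of `θ` to order `ρ` (BD96, full ring class tower) implies vanishing of `θ^{ac}` to
order `ρ` (images of `I_G^ρ` lie in `I_{G/Δ}^ρ`); the converse can fail when `Δ` has `p`-torsion. [folklore] -/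
theorem VanishesToOrder.ac {ρ : ℕ} (h : T.VanishesToOrder p φ α ρ) :
    T.VanishesToOrderAc p φ α ρ :=
  fun n => map_augIdeal_pow_le ℤ_[p] _ (acProj K p (n + 1)) ρ (Ideal.mem_map_of_mem _ (h n))

/-- Hence `ord(θ) ≤ ord_J(θ^{ac})`. [folklore] -/
theorem orderOfVanishing_le_acOrderOfVanishing :
    T.orderOfVanishing p φ α ≤ T.acOrderOfVanishing p φ α :=
  iSup₂_le fun ρ h => le_iSup₂ (f := fun (ρ : ℕ) (_ : T.VanishesToOrderAc p φ α ρ) => (ρ : ℕ∞))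
    ρ h.ac

/-- **`μ(θ^{ac}) = 0` in finite-level form**: for all large `n`, some coefficient of `θ_n^{ac}` is
a `p`-adic unit, i.e. `θ_n^{ac} ∉ p ℤ_p[G_n^{ac}]` (equivalent to `μ(L_f) = 0` for the limit
`L_f ∈ Λ`, `μ(Q) := max {c : Q ∈ p^c Λ}` as in Pollack–Weston 2011 §2.3, since
`⋂_n (p, ω_n) = pΛ`). [cite: PollackWeston2011, §2.3] -/
def HasMuZeroAc : Prop :=
  ∃ n₀ : ℕ, ∀ n, n₀ ≤ n → ∃ g, IsUnit ((T.thetaAc p φ α n).coeff g)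

end GrossPointTower

/-! ### Elliptic curves: `φ_E`, `α_p` and `θ_n(E, K)` -/

/-- A **generator `φ` of the eigen-line** `L(λ) = {v : T(q) v = λ(q) v, q ∤ N⁺N⁻ prime}` of the
Brandt matrices of the setup `S` in `ℤ^{Cls O}`, when that lattice is a line (`L = ℤ φ`,
`φ ≠ 0`; BD96 §1.9: "`J^f` is a `ℤ`-module of rank `1`; let `v_f` be a generator … Note that
there is an ambiguity of sign"); junk value `0` when it is not a line. [cite: BertoliniDarmon1996, §1.9] -/
def eigenGenerator {Nplus Nminus : ℕ} (S : Brandt.XiSetup Nplus Nminus)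
    [Fintype (Brandt.ClassSet S.O)] (lam : ℕ → ℤ) : Brandt.ClassSet S.O → ℤ :=
  open scoped Classical in
  if h : ∃ φ : Brandt.ClassSet S.O → ℤ, φ ≠ 0 ∧
      Brandt.eigenLattice (Nplus * Nminus) (Brandt.matrix S.O) lam = ℤ ∙ φ
  then h.choose else 0

/-- When the eigen-lattice is a line, `eigenGenerator` generates it. [folklore] -/
theorem eigenLattice_eq_span_eigenGenerator {Nplus Nminus : ℕ} (S : Brandt.XiSetup Nplus Nminus)
    [Fintype (Brandt.ClassSet S.O)] {lam : ℕ → ℤ}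
    (h : ∃ φ : Brandt.ClassSet S.O → ℤ, φ ≠ 0 ∧
      Brandt.eigenLattice (Nplus * Nminus) (Brandt.matrix S.O) lam = ℤ ∙ φ) :
    eigenGenerator S lam ≠ 0 ∧
      Brandt.eigenLattice (Nplus * Nminus) (Brandt.matrix S.O) lam = ℤ ∙ eigenGenerator S lam := by
  classical
  rw [eigenGenerator, dif_pos h]
  exact h.choose_spec

/-- **The `p`-adic unit root `α_p`** of `x² - a x + p` in `ℤ_p` (BD96 §2.5; BD05 §1.1: "let
`α_p ∈ ℤ_p` be the unique root of the polynomial `x² - a_p x + p` which is a `p`-adic unit",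
which exists iff `p ∤ a`, the ordinary case, by Hensel's lemma); junk value `1` if there is no
unit root. [cite: BertoliniDarmon2005, §1.1] -/
def padicUnitRoot (a : ℤ) : ℤ_[p]ˣ :=
  open scoped Classical in
  if h : ∃ u : ℤ_[p]ˣ, (u : ℤ_[p]) ^ 2 - a * u + p = 0 then h.choose else 1

/-- `padicUnitRoot p a` is a root of `x² - a x + p` whenever a unit root exists. [folklore] -/
theorem padicUnitRoot_spec {a : ℤ} (h : ∃ u : ℤ_[p]ˣ, (u : ℤ_[p]) ^ 2 - a * u + p = 0) :
    (padicUnitRoot p a : ℤ_[p]) ^ 2 - a * padicUnitRoot p a + p = 0 := by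
  classical
  rw [padicUnitRoot, dif_pos h]
  exact h.choose_spec

end Theta

/-- **`θ_{n+1}(E, K)`**, the theta element of level `n + 1` of the elliptic curve with
Weierstrass model `W` over `ℚ`, for the tower `T` of Gross points on the setup `S` of type
`(N⁺, N⁻)` (BD96 §2.7 with `φ = v_{f_E}` a generator of the `a(E)`-eigen-line,
`a_n(E) = W.LFunction n`, and `α = α_p(E)` the unit root of `x² - a_p(E) x + p`): an element of
`ℤ_p[Pic(𝒪_{p^{n+1}})]`, well defined up to sign (choice of `φ`) and depending on the tower
only up to translation by group elements. Meaningful when `N⁺N⁻ = N_E` with the primes of `N⁺`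
split and of `N⁻` inert in the imaginary quadratic field `K`, `p ∤ N_E` good ordinary (then
the eigen-line is a line by Jacquet–Langlands and `α_p` exists); junk branches otherwise
(`eigenGenerator`, `padicUnitRoot`, `GrossPointTower.theta`). [cite: BertoliniDarmon1996, §2.7] -/
def thetaOfCurve (p : ℕ) [Fact p.Prime] (W : WeierstrassCurve ℚ) {Nplus Nminus : ℕ}
    {S : Brandt.XiSetup Nplus Nminus} (T : GrossPointTower K S p) (n : ℕ) :
    MonoidAlgebra ℤ_[p] (ClassGroup (quadOrder K (p ^ (n + 1)))) :=
  letI := Fintype.ofFinite (Brandt.ClassSet S.O)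
  T.theta p (eigenGenerator S fun m => W.LFunction m) (padicUnitRoot p (W.LFunction p)) n

end Literature.NumberTheory.EllipticCurves

end
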